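import Summits.ResolutionOfSingularities.ResolutionOfSingularities.Theorems.WeightedInvariantHypersurfaceAdmissibleSuccessor
import HarnessLib

/-!
# The generic point of an integral closed subscheme is off the non-regular image of its ideal sheaf

Route `ResolutionOfSingularities/WeightedInvariant`, crux `Theses.WeightedInvariant.HypersurfaceCentreConstruction`
(stmt-ResolutionOfSingularities-19897), door line `local-engine`, H2c″ DOOR ASSEMBLY v1 of stub-9 = res-D-brk-1
(`door_assembly_eft3_v1.lean` sha16 c97a3399deb30939), sub-stub [S2] `stub_genericPoint_not_mem_support`:
for a closed immersion `i : X' ⟶ Y` with `X'` integral, the image `i ξ` of the generic point `ξ` of `X'` does not lie in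
`singImage i.ker` (the image in `Y` of the non-regular locus of `V(i.ker)`), hence lies in NO subset of it — in
particular not in the support of any centre confined to the non-regular image (the canonical centre of the assembly has
support `= maxLocus ⊆ singImage` by definition, so [S2] is this lemma with `S = R.support`). Closed-immersion form of the
tree's `not_mem_singImage_subschemeι_genericPoint` (`WeightedInvariantHypersurfaceAdmissibleSuccessor`), transported
along Mathlib's isomorphism `i.toImage : X' ⟶ i.ker.subscheme` (`IsIso` for a closed immersion; an isomorphism maps the
generic point to the generic point, `genericPoint_eq_of_isOpenImmersion`, and preserves integrality, `IsIntegral.of_isIso`).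
Def-free helper lemmas (`--supports stmt-ResolutionOfSingularities-19897`); nothing here is a claim about Hironaka's problem.
-/

noncomputable section

open CategoryTheory AlgebraicGeometry TopologicalSpace
open Literature.AlgebraicGeometry.Resolution

set_option linter.dupNamespace false -- mandated namespace of this single-conjunct summit

namespace Summit.ResolutionOfSingularities.ResolutionOfSingularities.Theorems

/-- The scheme-theoretic image `i.ker.subscheme` of a closed immersion with integral source is integral
(`i.toImage` is an isomorphism). [folklore] -/
theorem isIntegral_ker_subscheme_of_isClosedImmersion {X' Y : Scheme.{0}} (i : X' ⟶ Y) [IsClosedImmersion i]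
    [IsIntegral X'] : IsIntegral i.ker.subscheme :=
  IsIntegral.of_isIso i.toImage

/-- A closed immersion factors through its scheme-theoretic image on points: `i x = ι (i.toImage x)` with
`ι = i.ker.subschemeι`. [folklore] -/
theorem apply_eq_subschemeι_toImage_apply {X' Y : Scheme.{0}} (i : X' ⟶ Y) (x : X') :
    i x = i.ker.subschemeι (i.toImage x) := by
  rw [← Scheme.Hom.comp_apply, Scheme.Hom.toImage_imageι]

/-- **Dictionary: the non-regular image of `i.ker` is the image under `i` of the non-regular locus of `X'`.**
For a closed immersion `i : X' ⟶ Y`, `singImage i.ker = i '' {x ∈ X' | 𝒪_{X',x} not regular}` (transport of stalks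
along the isomorphism `i.toImage : X' ⟶ V(i.ker)`; `IsRegularLocalRing.of_ringEquiv`). [folklore] -/
theorem singImage_ker_eq_image_setOf_not_isRegularLocalRing {X' Y : Scheme.{0}} (i : X' ⟶ Y) [IsClosedImmersion i] :
    singImage i.ker = i '' {x : X' | ¬ IsRegularLocalRing (X'.presheaf.stalk x)} := by
  ext y
  constructor
  · rintro ⟨x, hx, hreg⟩
    refine ⟨(asIso i.toImage).inv x, fun hreg' => hreg ?_, ?_⟩
    · haveI := hreg'
      exact IsRegularLocalRing.of_ringEquiv
        (asIso (((asIso i.toImage).inv).stalkMap x)).commRingCatIsoToRingEquiv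
    · rw [apply_eq_subschemeι_toImage_apply, ← hx]
      exact congrArg _ (Scheme.inv_hom_apply (asIso i.toImage) x)
  · rintro ⟨x', hreg', rfl⟩
    refine ⟨i.toImage x', (apply_eq_subschemeι_toImage_apply i x').symm, fun hreg => hreg' ?_⟩
    haveI := hreg
    exact IsRegularLocalRing.of_ringEquiv (asIso (i.toImage.stalkMap x')).commRingCatIsoToRingEquiv

/-- **The image of the generic point of an integral closed subscheme is not in the non-regular image of its
ideal sheaf**: `i ξ_{X'} ∉ singImage i.ker` for a closed immersion `i : X' ⟶ Y` with `X'` integral (the only point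
of `V(i.ker) ≅ X'` over it is the generic point, whose local ring is the function field, a regular local ring).
[folklore] -/
theorem not_mem_singImage_ker_apply_genericPoint {X' Y : Scheme.{0}} (i : X' ⟶ Y) [IsClosedImmersion i]
    [IsIntegral X'] : i (genericPoint X') ∉ singImage i.ker := by
  haveI := isIntegral_ker_subscheme_of_isClosedImmersion i
  rw [apply_eq_subschemeι_toImage_apply, genericPoint_eq_of_isOpenImmersion i.toImage]
  exact not_mem_singImage_subschemeι_genericPoint i.ker

/-- **[S2] kernel.** Any subset `S ⊆ singImage i.ker` of the non-regular image — e.g. the support of a centre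
confined to it, such as the canonical centre of the H2c″ assembly (`support = maxLocus ⊆ singImage`) — misses the
image of the generic point of the integral `X'`. [folklore] -/
theorem apply_genericPoint_not_mem_of_subset_singImage {X' Y : Scheme.{0}} (i : X' ⟶ Y) [IsClosedImmersion i]
    [IsIntegral X'] {S : Set Y} (hS : S ⊆ singImage i.ker) : i (genericPoint X') ∉ S :=
  fun h => not_mem_singImage_ker_apply_genericPoint i (hS h)

/-- **[S2] kernel, Rees-algebra form.** A Rees algebra on `Y` whose support lies in `singImage i.ker` does not
contain the image of the generic point of the integral `X'` in its support. [folklore] -/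
theorem apply_genericPoint_not_mem_support_of_support_subset_singImage {X' Y : Scheme.{0}} (i : X' ⟶ Y)
    [IsClosedImmersion i] [IsIntegral X'] (R : ReesAlgebraData Y) (hR : R.support ⊆ singImage i.ker) :
    i (genericPoint X') ∉ R.support :=
  apply_genericPoint_not_mem_of_subset_singImage i hR

end Summit.ResolutionOfSingularities.ResolutionOfSingularities.Theorems

end
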